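import Mathlib.Analysis.Complex.Basic
import Mathlib.Analysis.Normed.Module.FiniteDimension
import Mathlib.Topology.Compactification.OnePoint.Basic
import Mathlib.Topology.VectorBundle.Constructions
import HarnessLib

/-!
# Complex topological vector bundles (bundled), Whitney sum, pull-back, and the tautological line bundle over `ℂP¹`

Topic `Literature/AlgebraicTopology/CharacteristicClasses`. The OBJECTS on which topological
characteristic classes are evaluated (companion file `TopologicalChernClasses`: the axioms
(C₀)–(C₃) of Chern classes and the Chern character), assembled from Mathlib's topological vector
bundles (`FiberBundle`, `VectorBundle ℂ F E`, `Bundle.Trivial`, `E₁ ×ᵇ E₂` / `VectorBundle.prod`,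
`f *ᵖ E` / `VectorBundle.pullback`, `VectorBundleCore`) and its one-point compactification
`OnePoint ℂ`:

* `ComplexVectorBundle B` — a finite-rank complex vector bundle over the topological space `B`:
  Mathlib's unbundled data (model fibre `F`, fibres `E x`, topologies, `FiberBundle F E`,
  `VectorBundle ℂ F E`) packed into one structure, so that "for every bundle `ξ` over `B`" can be
  quantified (Husemoller, *Fibre Bundles*, Ch. 3 §1); `rank`, `pullback f ξ = f^*ξ` (Ch. 3 §3),
  the Whitney sum `directSum ξ η = ξ ⊕ η` (Ch. 3 Def. 2.6), the product bundle `trivial B F`, and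
  `B`-isomorphisms `Iso` (Ch. 3 §2) with `refl/symm/trans` and `Iso.rank_eq`;
* `tautologicalLineBundle : ComplexVectorBundle (OnePoint ℂ)` — the canonical line bundle `γ¹`
  over `ℂP¹ = S²`, the bundle of the normalisation axiom (C₃) (Husemoller Ch. 17 (3.2);
  Milnor–Stasheff §14; Hirzebruch §4.2 Axiom IV uses its dual, the hyperplane bundle `η₁`), built
  as an explicit `VectorBundleCore` with the two standard charts.

## The model of `ℂP¹` and of `γ¹`

Mathlib has the projectivization `ℙ K V` as a type without topology, and the set-theoretic
identification `OnePoint.equivProjectivization : OnePoint K ≃ ℙ K (Fin 2 → K)`, `t ↦ [t : 1]`,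
`∞ ↦ [1 : 0]`. We therefore take `ℂP¹ := OnePoint ℂ` (the Riemann sphere `ℂ ∪ {∞}`, compact
Hausdorff; `onePointEquivSphereOfFinrankEq : OnePoint ℂ ≃ₜ S²`), with homogeneous coordinates
`[z₀ : z₁]`, `t = z₀/z₁`. The tautological line over `[z₀ : z₁]` is `ℂ·(z₀, z₁) ⊆ ℂ²`; on the chart
`finite = {z₁ ≠ 0} = range (ℂ → ℂP¹)` a vector `v` of the line is recorded by its coordinate `v₁`,
on `infinite = {z₀ ≠ 0} = {t ≠ 0} ∪ {∞}` by `v₀ = t v₁`. Hence the `VectorBundleCore` with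
`coordChange finite infinite [t:1] = (t · )` and `coordChange infinite finite [t:1] = (t⁻¹ · )`
(`tautologicalCore`; Hirzebruch §4.2: the cocycle `zᵢ/zⱼ` of `ℂⁿ⁺¹ ∖ 0 → P_n`, "associated to
`η_n⁻¹`… Thus `η_n⁻¹` is the universal bundle over `P_n(ℂ)`"; with his generator `h_n`,
`c₁(η_n⁻¹) = -h_n`). Changing `t` to `t⁻¹` in the transition would give the hyperplane bundle
`η₁ = γ¹*` instead — the reviewer's check-point for (C₃).

## Design notes

* Fibres are `AddCommMonoid` + `Module ℂ` exactly as in Mathlib's `VectorBundle`; the model fibre is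
  any finite-dimensional normed `ℂ`-space (`ℂ`, `Fin n → ℂ`, `F₁ × F₂`, …), `rank ξ = finrank ℂ F`.
* `Iso` asks continuity of BOTH total-space maps (Husemoller's definition of a `B`-isomorphism as a
  `B`-morphism with an inverse); for vector bundles the inverse is automatic (Ch. 3 Thm. 2.5), not
  re-proved here.
* Universes: `ComplexVectorBundle.{u, v} B` for `B : Type u`, fibres in `Type v`; the Chern class
  axioms of the companion file quantify over `B : Type` (complex points of varieties, `OnePoint ℂ`).
* Mathlib/tree search: no bundled complex vector bundles, no tautological bundle, no topology on
  `Projectivization` (`lean search 'tautological'`, `'TopologicalSpace (ℙ'`); the cocycle-PRESENTED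
  smooth bundles `Literature.Geometry.Kaehler.SmoothComplexVectorBundle` / `HolomorphicLineBundle`
  (Chern–Weil side) are a different formalism (no total space), deliberately not merged here.

## What is NOT here

`ℂPⁿ`, `ℂP^∞`, Grassmannians and universal bundles; conjugate, dual, tensor and `Hom` bundles;
classification of bundles; the homeomorphism `ℂP¹ ≅ S²` in use; characteristic classes (companion
file).

## References

* [HusemollerFibreBundles1994] D. Husemoller, *Fibre Bundles*, 3rd ed., GTM 20 (1994), Ch. 3 §§1–3,
  Def. 2.6, Thm. 2.5; Ch. 17 §3 (3.2).
* [Hirzebruch1966] F. Hirzebruch, *Topological Methods in Algebraic Geometry*, 3rd ed. (1966), §4.2.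
* [MilnorStasheffAMS76] J. Milnor, J. Stasheff, *Characteristic Classes* (1974), §14.
-/

noncomputable section

open Bundle Topology
open scoped OnePoint

universe u v w

namespace Literature.AlgebraicTopology.CharacteristicClasses

/-! ### Complex vector bundles (Mathlib's `VectorBundle ℂ F E`, bundled) -/

/-- A **complex vector bundle of finite rank** over the topological space `B`, i.e. the data of
Mathlib's topological vector bundles bundled into one object: a finite-dimensional normed model
fibre `F ≅ ℂⁿ`, the fibres `E x` (topological `ℂ`-modules), a topology on the total space, and
the local-triviality structure `FiberBundle F E` with `ℂ`-linear transition maps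
`VectorBundle ℂ F E` (Husemoller, Ch. 3 §1: an `n`-dimensional complex vector bundle `ξ` over `B`,
locally isomorphic to `U × ℂⁿ`). [cite: HusemollerFibreBundles1994, Ch. 3 §1] -/
structure ComplexVectorBundle (B : Type u) [TopologicalSpace B] : Type (max u (v + 1)) where
  /-- The model fibre (a finite-dimensional normed `ℂ`-space, `≅ ℂⁿ`). -/
  F : Type v
  [instNormedAddCommGroup : NormedAddCommGroup F]
  [instNormedSpace : NormedSpace ℂ F]
  [instFiniteDimensional : FiniteDimensional ℂ F]
  /-- The fibres. -/
  E : B → Type v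
  [instAddCommMonoid : ∀ x, AddCommMonoid (E x)]
  [instModule : ∀ x, Module ℂ (E x)]
  [instTopologicalSpaceTotalSpace : TopologicalSpace (TotalSpace F E)]
  [instTopologicalSpace : ∀ x, TopologicalSpace (E x)]
  [instFiberBundle : FiberBundle F E]
  [instVectorBundle : VectorBundle ℂ F E]

namespace ComplexVectorBundle

-- The structure's own instance-implicit FIELDS, re-exposed as instances on `X.F`, `X.E x`,
-- `TotalSpace X.F X.E` for `X : ComplexVectorBundle B` (the pattern of Mathlib's bundled objects,
-- e.g. `ModuleCat.isAddCommGroup`, `TopCat.str`); they apply only to these projections and override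
-- no Mathlib instance.
attribute [instance] instNormedAddCommGroup instNormedSpace instFiniteDimensional instAddCommMonoid
  instModule instTopologicalSpaceTotalSpace instTopologicalSpace instFiberBundle instVectorBundle

variable {B : Type u} [TopologicalSpace B]

/-- The rank `n = dim_ℂ F` of a complex vector bundle with model fibre `F ≅ ℂⁿ`
(Husemoller, Ch. 3 §1, "`n`-dimensional vector bundle"). [cite: HusemollerFibreBundles1994, Ch. 3 §1] -/
def rank (E : ComplexVectorBundle.{u, v} B) : ℕ := Module.finrank ℂ E.F

/-- The **induced (pull-back) bundle** `f^*(ξ)` of `ξ` along a continuous map `f : B' → B`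
(Husemoller, Ch. 2 §5 and Ch. 3 §3): fibre `E (f x)` over `x`; Mathlib's `f *ᵖ E` with its
vector bundle structure `VectorBundle.pullback`. [cite: HusemollerFibreBundles1994, Ch. 3 §3] -/
def pullback {B' : Type w} [TopologicalSpace B'] (f : C(B', B)) (E : ComplexVectorBundle.{u, v} B) :
    ComplexVectorBundle.{w, v} B' where
  F := E.F
  E := (f : B' → B) *ᵖ E.E

/-- The **Whitney sum** `ξ ⊕ η` of two complex vector bundles over `B` (Husemoller, Ch. 3
Def. 2.6: the fibre product, with fibre `ξ_b × η_b`); Mathlib's fibrewise product `E₁ ×ᵇ E₂`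
with model fibre `F₁ × F₂` and its vector bundle structure `VectorBundle.prod`.
[cite: HusemollerFibreBundles1994, Ch. 3 Def. 2.6] -/
def directSum (E₁ E₂ : ComplexVectorBundle.{u, v} B) : ComplexVectorBundle.{u, v} B where
  F := E₁.F × E₂.F
  E := fun x ↦ E₁.E x × E₂.E x

/-- The **trivial (product) bundle** `B × F` with fibre `F` (Husemoller, Ch. 3 Ex. 1.4);
Mathlib's `Bundle.Trivial B F`. [cite: HusemollerFibreBundles1994, Ch. 3 §1] -/
def trivial (B : Type u) [TopologicalSpace B] (F : Type v) [NormedAddCommGroup F]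
    [NormedSpace ℂ F] [FiniteDimensional ℂ F] : ComplexVectorBundle.{u, v} B where
  F := F
  E := Bundle.Trivial B F

/-- The rank of `f^* ξ` is the rank of `ξ`. [folklore] -/
@[simp]
theorem rank_pullback {B' : Type w} [TopologicalSpace B'] (f : C(B', B))
    (E : ComplexVectorBundle.{u, v} B) : (E.pullback f).rank = E.rank := rfl

/-- `rank (ξ ⊕ η) = rank ξ + rank η`. [folklore] -/
@[simp]
theorem rank_directSum (E₁ E₂ : ComplexVectorBundle.{u, v} B) :
    (E₁.directSum E₂).rank = E₁.rank + E₂.rank :=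
  Module.finrank_prod

/-- The rank of the trivial bundle with fibre `F` is `dim F`. [folklore] -/
@[simp]
theorem rank_trivial (F : Type v) [NormedAddCommGroup F] [NormedSpace ℂ F]
    [FiniteDimensional ℂ F] : (trivial B F).rank = Module.finrank ℂ F := rfl

/-- A **`B`-isomorphism** `u : ξ ≅ η` of complex vector bundles over the same base (Husemoller,
Ch. 3 §2: a `B`-morphism of vector bundles — continuous on total spaces, the identity on `B`,
linear on fibres — with an inverse `B`-morphism): a family of continuous linear equivalences of
the fibres whose induced maps of total spaces, in both directions, are continuous.
[cite: HusemollerFibreBundles1994, Ch. 3 §2] -/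
structure Iso (E₁ E₂ : ComplexVectorBundle.{u, v} B) where
  /-- The fibrewise continuous linear equivalences. -/
  equiv (x : B) : E₁.E x ≃L[ℂ] E₂.E x
  /-- The induced map of total spaces `ξ → η` is continuous. -/
  continuous_toFun :
    Continuous fun p : TotalSpace E₁.F E₁.E ↦ (⟨p.proj, equiv p.proj p.snd⟩ : TotalSpace E₂.F E₂.E)
  /-- The induced map of total spaces `η → ξ` is continuous. -/
  continuous_invFun :
    Continuous fun p : TotalSpace E₂.F E₂.E ↦
      (⟨p.proj, (equiv p.proj).symm p.snd⟩ : TotalSpace E₁.F E₁.E)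

namespace Iso

/-- The identity isomorphism. [folklore] -/
def refl (E : ComplexVectorBundle.{u, v} B) : E.Iso E where
  equiv x := ContinuousLinearEquiv.refl ℂ (E.E x)
  continuous_toFun := continuous_id
  continuous_invFun := continuous_id

/-- The inverse isomorphism. [folklore] -/
def symm {E₁ E₂ : ComplexVectorBundle.{u, v} B} (e : E₁.Iso E₂) : E₂.Iso E₁ where
  equiv x := (e.equiv x).symm
  continuous_toFun := e.continuous_invFun
  continuous_invFun := e.continuous_toFun

/-- Composition of isomorphisms. [folklore] -/
def trans {E₁ E₂ E₃ : ComplexVectorBundle.{u, v} B} (e : E₁.Iso E₂) (e' : E₂.Iso E₃) :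
    E₁.Iso E₃ where
  equiv x := (e.equiv x).trans (e'.equiv x)
  continuous_toFun := e'.continuous_toFun.comp e.continuous_toFun
  continuous_invFun := e.continuous_invFun.comp e'.continuous_invFun

/-- Isomorphic bundles over a nonempty base have the same rank (compare fibres over a point with the
model fibres through trivialisations). [cite: HusemollerFibreBundles1994, Ch. 3 §2] -/
theorem rank_eq [Nonempty B] {E₁ E₂ : ComplexVectorBundle.{u, v} B} (e : E₁.Iso E₂) :
    E₁.rank = E₂.rank := by
  obtain ⟨x⟩ := ‹Nonempty B›
  have h₁ := VectorBundle.continuousLinearEquivAt ℂ E₁.F E₁.E x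
  have h₂ := VectorBundle.continuousLinearEquivAt ℂ E₂.F E₂.E x
  exact (h₁.symm.toLinearEquiv.trans ((e.equiv x).toLinearEquiv.trans h₂.toLinearEquiv)).finrank_eq

end Iso

end ComplexVectorBundle

/-! ### The projective line `ℂP¹ = ℂ ∪ {∞}` and its tautological line bundle -/

/-- The two standard charts of `ℂP¹`, in homogeneous coordinates `[z₀ : z₁]` with Mathlib's
identification `OnePoint ℂ ≃ ℙ ℂ (Fin 2 → ℂ)`, `t ↦ [t : 1]`, `∞ ↦ [1 : 0]`
(`OnePoint.equivProjectivization`): `finite` is `U₁ = {z₁ ≠ 0} = {[t : 1]} = ℂ` and `infinite`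
is `U₀ = {z₀ ≠ 0} = {t ≠ 0} ∪ {∞}` (Hirzebruch, §4.2: "The open sets `Uᵢ` defined by `zᵢ ≠ 0`
form an open covering of `P_n(ℂ)`"). [cite: Hirzebruch1966, §4.2] -/
inductive ProjectiveLineChart
  /-- the affine chart `{[t : 1]} = ℂ` -/
  | finite
  /-- the chart `{[1 : s]} = {t ≠ 0} ∪ {∞}` at infinity -/
  | infinite
  deriving DecidableEq, Inhabited

namespace ProjectiveLineChart

/-- The domains of the two charts: `range (ℂ → ℂP¹)` and `{x ≠ [0 : 1]}`. [cite: Hirzebruch1966, §4.2] -/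
def baseSet : ProjectiveLineChart → Set (OnePoint ℂ)
  | finite => Set.range ((↑) : ℂ → OnePoint ℂ)
  | infinite => {x | x ≠ ((0 : ℂ) : OnePoint ℂ)}

/-- The transition functions `g_{ji}` of the TAUTOLOGICAL line bundle `{([z], v) | v ∈ ℂ·z}`:
chart `i` records the coordinate `vᵢ` of a vector `v` of the line `[z₀ : z₁]`, so from `finite`
(coordinate `v₁`) to `infinite` (coordinate `v₀`) one multiplies by `z₀/z₁ = t`, and back by
`t⁻¹` (Hirzebruch, §4.2: the cocycle `zᵢ/zⱼ` of `ℂⁿ⁺¹ ∖ 0 → P_n(ℂ)`, "associated to `η_n⁻¹`";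
the HYPERPLANE bundle `η_n` has the inverse cocycle `zⱼ zᵢ⁻¹`). Junk value `1` off the
overlap. [cite: Hirzebruch1966, §4.2] -/
def transition : ProjectiveLineChart → ProjectiveLineChart → OnePoint ℂ → ℂ
  | finite, infinite, x => x.elim 1 id
  | infinite, finite, x => x.elim 1 Inv.inv
  | _, _, _ => 1

/-- The chart used at a point: `infinite` at `∞`, `finite` elsewhere. [folklore] -/
def indexAt (x : OnePoint ℂ) : ProjectiveLineChart := x.elim infinite fun _ ↦ finite

/-- A chart has trivial transition to itself. [folklore] -/
@[simp] lemma transition_finite_finite (x : OnePoint ℂ) : transition finite finite x = 1 := rfl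

/-- A chart has trivial transition to itself. [folklore] -/
@[simp] lemma transition_infinite_infinite (x : OnePoint ℂ) : transition infinite infinite x = 1 :=
  rfl

/-- From the affine chart to the chart at infinity the transition at `[t : 1]` is `t`.
[cite: Hirzebruch1966, §4.2] -/
@[simp] lemma transition_finite_infinite_coe (t : ℂ) : transition finite infinite t = t := rfl

/-- From the chart at infinity to the affine chart the transition at `[t : 1]` is `t⁻¹`.
[cite: Hirzebruch1966, §4.2] -/
@[simp] lemma transition_infinite_finite_coe (t : ℂ) : transition infinite finite t = t⁻¹ := rfl

/-- The affine chart consists of the finite points `[t : 1]`. [folklore] -/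
lemma mem_baseSet_finite_iff {x : OnePoint ℂ} :
    x ∈ baseSet finite ↔ ∃ t : ℂ, (t : OnePoint ℂ) = x :=
  Iff.rfl

/-- The chart at infinity is the complement of `[0 : 1]`. [folklore] -/
lemma mem_baseSet_infinite_iff {x : OnePoint ℂ} :
    x ∈ baseSet infinite ↔ x ≠ ((0 : ℂ) : OnePoint ℂ) := Iff.rfl

/-- A finite point `[t : 1]` lies in the chart at infinity iff `t ≠ 0`. [folklore] -/
lemma coe_mem_baseSet_infinite_iff {t : ℂ} : (t : OnePoint ℂ) ∈ baseSet infinite ↔ t ≠ 0 := by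
  rw [mem_baseSet_infinite_iff, Ne, OnePoint.coe_eq_coe]

/-- `∞ = [1 : 0]` is not in the affine chart. [folklore] -/
lemma infty_not_mem_baseSet_finite : (∞ : OnePoint ℂ) ∉ baseSet finite :=
  OnePoint.infty_notMem_range_coe

end ProjectiveLineChart

open ProjectiveLineChart in
/-- The **tautological line bundle `γ¹` over `ℂP¹ = OnePoint ℂ`** as a Mathlib `VectorBundleCore`:
fibre `ℂ`, the two charts `finite = {[t : 1]}`, `infinite = {[1 : s]}`, and transition
"multiplication by `t = z₀/z₁`" from `finite` to `infinite` (the line over `[z₀ : z₁]` is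
`ℂ·(z₀, z₁)`; chart `i` reads off the coordinate `vᵢ`). This is Husemoller's canonical line bundle
`λ` over `S² = ℂP¹` of (C₃) / Milnor–Stasheff's `γ¹₁`, and Hirzebruch's `η₁⁻¹` (so that, with
Hirzebruch's positive generator `h₁`, `c₁(γ¹) = -h₁`). [cite: Hirzebruch1966, §4.2]
[cite: HusemollerFibreBundles1994, Ch. 17 §3 (3.2) (C₃)] -/
def tautologicalCore : VectorBundleCore ℂ (OnePoint ℂ) ℂ ProjectiveLineChart where
  baseSet := baseSet
  isOpen_baseSet i := by
    cases i
    · exact OnePoint.isOpen_range_coe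
    · exact isOpen_ne
  indexAt := indexAt
  mem_baseSet_at x := by
    induction x using OnePoint.rec with
    | infty => exact OnePoint.infty_ne_coe 0
    | coe t => exact ⟨t, rfl⟩
  coordChange i j x := transition i j x • ContinuousLinearMap.id ℂ ℂ
  coordChange_self i x _ v := by cases i <;> simp
  continuousOn_coordChange i j := by
    have h : ContinuousOn (transition i j) (baseSet i ∩ baseSet j) := by
      rintro x ⟨hi, hj⟩
      cases i <;> cases j
      · exact continuousWithinAt_const
      · obtain ⟨t, rfl⟩ := hi
        refine ContinuousAt.continuousWithinAt (OnePoint.continuousAt_coe.2 ?_)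
        exact continuousAt_id
      · obtain ⟨t, rfl⟩ := hj
        refine ContinuousAt.continuousWithinAt (OnePoint.continuousAt_coe.2 ?_)
        exact continuousAt_inv₀ (coe_mem_baseSet_infinite_iff.1 hi)
      · exact continuousWithinAt_const
    exact h.smul continuousOn_const
  coordChange_comp := by
    rintro i j k x ⟨⟨hi, hj⟩, hk⟩ v
    induction x using OnePoint.rec with
    | infty =>
      cases i
      · exact (infty_not_mem_baseSet_finite hi).elim
      cases j
      · exact (infty_not_mem_baseSet_finite hj).elim
      cases k
      · exact (infty_not_mem_baseSet_finite hk).elim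
      simp
    | coe t =>
      have h0 : (t : OnePoint ℂ) ∈ baseSet infinite → t ≠ 0 := coe_mem_baseSet_infinite_iff.1
      cases i <;> cases j <;> cases k <;> simp_all [mul_inv_cancel_left₀, inv_mul_cancel_left₀]

/-- **The tautological line bundle `γ¹` over `ℂP¹`** (`ℂP¹` modelled as `OnePoint ℂ = ℂ ∪ {∞}`,
`t ↔ [t : 1]`, `∞ ↔ [1 : 0]`, Mathlib `OnePoint.equivProjectivization`): the complex line bundle
of `tautologicalCore` — Husemoller's "canonical line bundle `λ` over `S² = ℂP¹`" of axiom (C₃).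
[cite: HusemollerFibreBundles1994, Ch. 17 §3 (3.2) (C₃)] [cite: Hirzebruch1966, §4.2] -/
def tautologicalLineBundle : ComplexVectorBundle.{0, 0} (OnePoint ℂ) where
  F := ℂ
  E := tautologicalCore.Fiber

/-- `γ¹` is a line bundle. [folklore] -/
@[simp]
theorem rank_tautologicalLineBundle : tautologicalLineBundle.rank = 1 := Module.finrank_self ℂ

/-- The transition function of `γ¹` from the affine chart to the chart at infinity, at `[t : 1]`,
`t ≠ 0`, is multiplication by `t`. [cite: Hirzebruch1966, §4.2] -/
theorem tautologicalCore_coordChange_apply (t v : ℂ) :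
    tautologicalCore.coordChange .finite .infinite t v = t * v := by
  simp [tautologicalCore]


end Literature.AlgebraicTopology.CharacteristicClasses
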